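import Summits.ABC.IUTFork.Cor312LogKummerRoute2
import Summits.ABC.IUTFork.Cor312IndVolumeInvariance
import Summits.ABC.IUTFork.Cor312IndVolumeReal
import Summits.ABC.IUTFork.Cor312ThetaAdmReal
import HarnessLib

/-!
# [IUTchIII] Cor. 3.12 — TEAM B CAPSTONE: the printed Statement from the typed Theorem 3.11, instance
# data, and ONE residual comparison

Record-only file (D-0012) of the abc-iut cell (Cor. 3.12 strategy TEAM B «estimate / log-Kummer» of
HUMAN RULING D-0067 (3); seat abc-iut-c312-12 = B2, composing per abc-iut-c312-11's 00:04Z assignment);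
TAKES NO SIDE. The TEAM B ledger after rows B-1…B-4 (c312-11's two-layer route p411119/p411632/p411648;
B2's criteria p411395/p411464/p411624/p412063/p412682/p413177):

`teamB_capstone_of_latticeRealisations` — **the printed `Statement` of Cor. 3.12 follows in the kernel
from**:

1. the WHOLE typed Theorem 3.11 (`FullSituation.Statement` = (i) ∧ (ii) ∧ (iii), abc-iut-c312-1's
   author-terms interfaces — in particular (ii) (a) `KummerA` is consumed through c312-11's layer 2);
2. INSTANCE DATA of single-Haar-container type, all of it of the shape the real instantiations carry:
   container readings of the mono-analytic log-volume/admissibility (`Thm311LogvolInvariance`), the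
   (Ind1)/(Ind2) generator families and the Kummer isomorphisms realised by homeomorphisms mapping SOME
   integral structure onto itself (Dupuy–Hilado §4.7/§4.9, [IUTchIII] Prop. 3.1 (ii); witnesses at the
   Dupuy–Hilado shells: `Cor312IndVolumeReal`), the Kummer images of the Θ-pilot object realised from
   ONE reference region of positive finite volume ([IUTchIII] Prop. 3.9 (i)), monotonicity, the
   (Ind3)-region data (admissible, finitely supported, nonempty) and the Corollary's own finiteness
   clause `ThetaFinite`;
3. **`QFrobEqualityAt P 0`** — the ONE residual input: the (xi-g) sentence as printed ("two
   tautologically equivalent ways to compute the log-volume of the `q`-pilot object at `(1,0)`",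
   kurims p. 184 l. 30–34), at the gluing position, holomorphic side. This is the gap row
   G-c312-11-1 of `plan/GAP-LEDGER.md`; whether it follows from the frozen FACT LIST is the
   adjudication — NOTHING here asserts it.

Proof = composition of landed pieces, no new mathematics: B2's
`ind_adm_iff_and_logvolInvariant_of_latticeRealisations` (p411395) feeds c312-11's
`bridgeHyps_of_generators` (p411632) for the bridge hypotheses; B2's
`thetaRegionsAdm_of_latticeRealisations` (p413177) discharges `ThetaRegionsAdm`; c312-11's
`qFrobComparison_of_equalityAt` + `statement_of_thm311` (p411648) close the route. Satisfiability: the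
ROUTE-level hypotheses are witnessed by `Cor312LogKummerRoute2.Checks`'s toy columns; the container
READING hypotheses are of the shape the real instantiations carry (a Haar-container witness is any
nonarchimedean local field with its integral structure — `LogShellVolumeInvariance`), not re-witnessed
here. A-side kernel gap isolation (`Cor312TeamAGapWitness`) shows clause 3 cannot be dropped. Sources: [IUTchIII] pp. 153–156, 173–186;
Dupuy–Hilado §4.7–4.9. [claim: Mochizuki2012, status: disputed] [cite: DupuyHilado2025, §4.9]
Deliberately NOT here: any assertion of clause 3, the weighted/frames containers (c312-6 g3), the
instance data itself (c312-3 W2-G / c312-5-successor), any judgement on Cor. 3.12.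
-/

noncomputable section

open Set
open Literature.IUT.LogVolume

namespace Summit.ABC

namespace IUTFork

namespace Cor312Vol

open Thm311 Cor312 Literature.IUT.LogThetaLattice

variable {T : ThetaIndex} {S'' : FullSituation T} (P : Cor312.Setting S''.toSituation)
variable {W : T.Label → T.VQ → Type*} [∀ j vQ, AddCommGroup (W j vQ)]
  [∀ j vQ, TopologicalSpace (W j vQ)] [∀ j vQ, IsTopologicalAddGroup (W j vQ)]
  [∀ j vQ, MeasurableSpace (W j vQ)] [∀ j vQ, BorelSpace (W j vQ)]
  (Λ : ∀ j vQ, IntegralStructure (W j vQ)) (d : T.Label → T.VQ → ℕ)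
  (e : ∀ (j : T.Label) (vQ : T.VQ), S''.L.Packet j vQ → W j vQ)
  (ψ : ℤ → ∀ (j : T.Label) (vQ : T.VQ), W j vQ ≃ₜ+ W j vQ)
  (R : ∀ (j : T.Label) (vQ : T.VQ), Set (S''.L.Packet j vQ))

/-- **TEAM B CAPSTONE** — the printed `Statement` of [IUTchIII] Cor. 3.12 from (1) the whole typed
Theorem 3.11, (2) single-Haar-container instance data (readings; lattice-carrying realisations of the
(Ind1)/(Ind2) families and of the Kummer isomorphisms; one positive-finite reference region;
monotonicity; (Ind3)-region data; `ThetaFinite`), and (3) the ONE residual comparison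
`QFrobEqualityAt P 0` (= gap row G-c312-11-1, the printed (xi-g) sentence at the gluing position).
Composition of p411395 + p411632 + p413177 + p411648; nothing asserted.
[claim: Mochizuki2012, status: disputed] -/
theorem teamB_capstone_of_latticeRealisations
    (hlogvol : ∀ (j : T.Label) (vQ : T.VQ) (A : Set (S''.L.Packet j vQ)),
      (S''.toSituation.D P.n).logvol j vQ A =
        (Λ j vQ).normalizedLogVolume (d j vQ) (e j vQ '' A))
    (hAdm : ∀ (j : T.Label) (vQ : T.VQ) (A : Set (S''.L.Packet j vQ)),
      (S''.toSituation.D P.n).Adm j vQ A ↔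
        0 < (Λ j vQ).haar (e j vQ '' A) ∧ (Λ j vQ).haar (e j vQ '' A) < ⊤)
    (hInd : ∀ Φ : S''.L.PacketAut, (Φ ∈ S''.L.Ind1Family ∨ Φ ∈ S''.L.Ind2Family) →
      ∀ (j : T.Label) (vQ : T.VQ),
      ∃ (χ : W j vQ ≃ₜ+ W j vQ) (Λ₀ : IntegralStructure (W j vQ)),
        χ '' (Λ₀ : Set (W j vQ)) = (Λ₀ : Set (W j vQ)) ∧ ∀ x, e j vQ (Φ j vQ x) = χ (e j vQ x))
    (hψ : ∀ (m : ℤ) (j : T.Label) (vQ : T.VQ), ∃ Λ₀ : IntegralStructure (W j vQ),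
      ψ m j vQ '' (Λ₀ : Set (W j vQ)) = (Λ₀ : Set (W j vQ)))
    (hthetaEq : ∀ (m : ℤ) (i : Fin T.lstar) (vQ : T.VQ),
      e (Setting.labelSucc i) vQ '' P.thetaRegion m (Setting.labelSucc i) vQ =
        ψ m (Setting.labelSucc i) vQ '' (e (Setting.labelSucc i) vQ '' R (Setting.labelSucc i) vQ))
    (hR : ∀ (i : Fin T.lstar) (vQ : T.VQ),
      0 < (Λ (Setting.labelSucc i) vQ).haar
          (e (Setting.labelSucc i) vQ '' R (Setting.labelSucc i) vQ) ∧
        (Λ (Setting.labelSucc i) vQ).haar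
          (e (Setting.labelSucc i) vQ '' R (Setting.labelSucc i) vQ) < ⊤)
    (hmono : LogvolMono P)
    (h3adm : ∀ (i : Fin T.lstar) (vQ : T.VQ),
      (S''.toSituation.D P.n).Adm (Setting.labelSucc i) vQ
        (P.thetaRegion3 (Setting.labelSucc i) vQ))
    (h3fin : ∀ i : Fin T.lstar, (Function.support fun vQ =>
      (S''.toSituation.D P.n).logvol (Setting.labelSucc i) vQ
        (P.thetaRegion3 (Setting.labelSucc i) vQ)).Finite)
    (hulne : ∀ (j : T.Label) (vQ : T.VQ), ∀ H ∈ (P.frame j vQ).Hul, H.Nonempty)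
    (h3ne : ∀ (i : Fin T.lstar) (vQ : T.VQ),
      (P.thetaRegion3 (Setting.labelSucc i) vQ).Nonempty)
    (hfin : P.ThetaFinite)
    (h311 : S''.Statement)
    (hQ : QFrobEqualityAt (S' := S''.toLatticeSituation) P 0) : P.Statement := by
  have hcrit := (S''.toSituation.D P.n).ind_adm_iff_and_logvolInvariant_of_latticeRealisations
    Λ d e hlogvol hAdm hInd
  have H : BridgeHyps P :=
    bridgeHyps_of_generators P hmono hcrit.1 hcrit.2 h3adm h3fin hulne h3ne hfin
  have hadm : ThetaRegionsAdm P :=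
    thetaRegionsAdm_of_latticeRealisations P Λ e ψ R hAdm hψ hthetaEq hR
  exact statement_of_thm311 P H h311 hadm (qFrobComparison_of_equalityAt hQ)

end Cor312Vol

end IUTFork

end Summit.ABC

end
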